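import Summits.MatrixMultiplication.MatrixMultiplication.Theorems.ObstructionDescentEmptyLevelFormat
import Literature.Computability.AlgebraicComplexity.UnitTensorMomentPolytopeProofs

set_option linter.dupNamespace false

/-!
# Obstruction descent, part S — invariant saturation in the square regime `m ≥ N²` (scale `τ ≥ 4`)

`route-MatrixMultiplication-ObstructionDescent`, aside `InvariantSaturation` (stmt 32282); decomp-mm lens-3, NODE-g15.

The aside `InvariantSaturation` asks (read in levels, `invariantSaturation_iff_levels`): for scales `2 < τ < 4`, eventually
in `n`, for `m ≥ n², n^τ`, every level `k` with `k n² > m` of the corner tower of block format `N = n²` PASSES (has a vector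
non-zero on `GL_m³·⟨m⟩`) OR is EMPTY.  This file proves that dichotomy UNCONDITIONALLY in the square regime `m ≥ N²`
— i.e. at every scale `τ ≥ 4`, for ALL levels — so that the window `2 < τ < 4` of the item is exactly what is open.

Mechanism: a corner vector is a lift, `F = liftPoly d f` (part L), and `F(pad s) = f(s)` for every corner tensor `s`
(`cornerOf_padTensor`); a vector in the ideal of `GL_m³·⟨m⟩` vanishes on every tensor of rank `≤ m`
(`evalT_eq_zero_of_tensorRank_le`, locality), and every `N×N×N` tensor has rank `≤ N² ≤ m`; so `f` vanishes everywhere,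
`f = 0`, `F = 0` (`eq_zero_of_mem_orbitVanishing_of_sq_le`).  Hence `k ∈ passLevels m N ∪ emptyLevels m N` for all `k`
when `N² ≤ m` (`mem_passLevels_union_emptyLevels_of_sq_le`), and the scale-`τ ≥ 4` companion of the item
(`levels_dichotomy_of_four_le`).

[cite: BurgisserIkenmeyer2011, §3.1–3.2, Lemma 3.2], [cite: BurgisserIkenmeyer2017, §5 (5.2), Thm 5.3],
[cite: LandsbergGCT2017, §8.3.4].
-/

noncomputable section

open scoped BigOperators
open Finset

namespace Summit.MatrixMultiplication.MatrixMultiplication.Theorems.ObstructionCalculus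

open Literature.Computability.AlgebraicComplexity (unitTensor tensorRank tensorRank_le_card_mul_card₁₂)
open Summit.MatrixMultiplication.MatrixMultiplication.Theorems.ObstructionDescentCornerEquations (tensorRank_padTensor_le)

section SquareRegime

/-- Every tensor of format `N` has rank `≤ N²`. [bookkeeping] -/
theorem tensorRank_le_sq {N : ℕ} (s : Tensor ℂ N) : tensorRank s ≤ N * N := by
  simpa [Fintype.card_fin] using tensorRank_le_card_mul_card₁₂ s

/-- **Saturation in the square regime, per vector.**  For `N² ≤ m` (and `N ≤ m`), a weight vector of corner type
`rectType m N k` (degree `kN`) lying in the ideal of the unit-tensor orbit `GL_m³·⟨m⟩` is zero. [this node] -/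
theorem eq_zero_of_mem_orbitVanishing_of_sq_le {m N k : ℕ} (hNm : N ≤ m) (hsq : N * N ≤ m)
    {F : MvPolynomial (Idx m) ℂ} (hF : F ∈ hwvSpace (rectType m N k) (k * N))
    (h0 : F ∈ orbitVanishing (unitTensor ℂ m)) : F = 0 := by
  obtain ⟨d, rfl⟩ : ∃ d, m = d + N := ⟨m - N, by omega⟩
  obtain ⟨f, -, rfl⟩ := exists_eq_liftPoly_of_mem_hwvSpace le_rfl hF
  suffices hf0 : f = 0 by simp [hf0, liftPoly]
  apply MvPolynomial.funext
  intro v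
  have h := evalT_eq_zero_of_tensorRank_le h0 (u := padTensor (Fin.natAdd d) fun a b c => v (a, b, c))
    ((tensorRank_padTensor_le _ _).trans ((tensorRank_le_sq _).trans hsq))
  rw [evalT_liftPoly, cornerOf_padTensor, evalT, MvPolynomial.aeval_eq_eval] at h
  rw [map_zero]
  simpa only [Prod.mk.eta] using h

/-- **Saturation in the square regime, level form:** for `N ≤ m` and `N² ≤ m`, every level of block format `N` passes or
is empty. [this node] -/
theorem mem_passLevels_union_emptyLevels_of_sq_le {m N : ℕ} (hNm : N ≤ m) (hsq : N * N ≤ m) (k : ℕ) :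
    k ∈ passLevels m N ∪ emptyLevels m N := by
  by_cases hp : k ∈ passLevels m N
  · exact Or.inl hp
  · refine Or.inr ?_
    have hle : hwvSpace (rectType m N k) (k * N) ≤ orbitVanishing (unitTensor ℂ m) := not_not.mp hp
    show hwvSpace (rectType m N k) (k * N) = ⊥
    rw [Submodule.eq_bot_iff]
    exact fun F hF => eq_zero_of_mem_orbitVanishing_of_sq_le hNm hsq hF (hle hF)

/-- The same for `1 ≤ N` (then `N ≤ N² ≤ m`). [this node] -/
theorem mem_passLevels_union_emptyLevels_of_sq_le' {m N : ℕ} (hN : 1 ≤ N) (hsq : N * N ≤ m) (k : ℕ) :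
    k ∈ passLevels m N ∪ emptyLevels m N :=
  mem_passLevels_union_emptyLevels_of_sq_le ((Nat.le_mul_of_pos_left N hN).trans hsq) hsq k

/-- **The scale-`τ ≥ 4` companion of `InvariantSaturation` is a theorem:** for every `τ ≥ 4` and all `n, m` with
`n² ≤ m`, `n^τ ≤ m`, EVERY level `k` of block format `n²` passes or is empty (no threshold `k n² > m`, no `n₀`).
Compare `invariantSaturation_iff_levels` (the item: the same dichotomy for `2 < τ < 4`, levels `k n² > m`). [this node] -/
theorem levels_dichotomy_of_four_le (τ : ℝ) (hτ : 4 ≤ τ) (n m : ℕ) (hnm : n * n ≤ m) (hτm : (n : ℝ) ^ τ ≤ (m : ℝ))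
    (k : ℕ) : k ∈ passLevels m (n * n) ∪ emptyLevels m (n * n) := by
  refine mem_passLevels_union_emptyLevels_of_sq_le hnm ?_ k
  rcases Nat.eq_zero_or_pos n with rfl | hn
  · simp
  · have h1 : (1 : ℝ) ≤ n := by exact_mod_cast hn
    have h4 : (n : ℝ) ^ (4 : ℝ) ≤ (n : ℝ) ^ τ := Real.rpow_le_rpow_of_exponent_le h1 hτ
    have h4' : ((n * n * (n * n) : ℕ) : ℝ) = (n : ℝ) ^ (4 : ℝ) := by
      rw [show (4 : ℝ) = ((4 : ℕ) : ℝ) by norm_num, Real.rpow_natCast]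
      push_cast
      ring
    exact_mod_cast (h4'.le.trans (h4.trans hτm))

/-- In the form of the item's inlined conclusion: for `τ ≥ 4`, `n² ≤ m`, `n^τ ≤ m`, any level `k` of block format `n²`
all of whose vectors vanish on `GL_m³·⟨m⟩` is empty. [this node] -/
theorem hwvSpace_eq_bot_of_le_orbitVanishing_of_four_le (τ : ℝ) (hτ : 4 ≤ τ) (n m : ℕ) (hnm : n * n ≤ m)
    (hτm : (n : ℝ) ^ τ ≤ (m : ℝ)) (k : ℕ)
    (h : hwvSpace (rectType m (n * n) k) (k * (n * n)) ≤ orbitVanishing (unitTensor ℂ m)) :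
    hwvSpace (rectType m (n * n) k) (k * (n * n)) = ⊥ := by
  rcases levels_dichotomy_of_four_le τ hτ n m hnm hτm k with hp | he
  · exact absurd h hp
  · exact he

end SquareRegime

end Summit.MatrixMultiplication.MatrixMultiplication.Theorems.ObstructionCalculus

end
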